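import Summits.AtomisticToContinuum.FouriersLaw.Theses.BondHeatUncertainty
import Summits.AtomisticToContinuum.FouriersLaw.Theorems.BondHeatUncertaintySubdiffusiveBondHeatOfDeficitCesaroEW

/-!
# `LightConeBondHeat` from the light-cone Edwards–Wilkinson law of the bath heat (bath-bond transfer)

Support file for item `stmt-AtomisticToContinuum-9123` (`BondHeatUncertainty.LightConeBondHeat`, (S_lc)): the
`N`-uniform `√t` bound on the equilibrium bond-heat variance `V_N(b,t) = 2∫₀ᵗ (t−s) C_N(b,s) ds` of ONE bond of the pinned
anharmonic chain on the LIGHT-CONE window `1 ≤ t ≤ a·N`.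

The crux `SubdiffusiveBondHeat` (S) (stmt-9120, Thouless window `1 ≤ t ≤ cN²`) implies (S_lc)
(`lightConeBondHeat_of_subdiffusiveBondHeat`), and along the line `bath-bond-deficit-integral` (S) is reduced to ONE open
`N`-uniform statement, the Cesàro Edwards–Wilkinson bound of the boundary escape-deficit curve
`∫₀ᵗ (1 − θ_N(s)) ds ≤ C√t` on `[1, cN²]` (`subdiffusiveBondHeat_of_deficitCesaroEW`, landed).  This file records the
light-cone version of that transfer, so that (S_lc) is pinned to the correspondingly WEAKER light-cone input:

* `lightConeBondHeat_of_lightConeDeficitCesaro` — (S_lc) follows from `∫₀ᵗ (1 − θ_N(s)) ds ≤ C√t` for `1 ≤ t ≤ a·N`,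
  `N ≥ N₀` (`θ_N(s) = (γ/T²)∫₀ˢ K_N`, `K_N(u) = ∫ (p₀² − T)·P_u(p₀² − T) dμ_T`, VERBATIM the `let θ`, `let K` of route
  `BoundaryEscapeDeficit`), i.e. from the EW ¼-law `Var_eq(Q^L_t) ≤ 2γT²C√t` of the heat exchanged with ONE reservoir
  INSIDE THE LIGHT CONE only — where, by finite speed of propagation, the open `N`-chain at the bath bond is the
  semi-infinite chain with one bath.  Proof: witness bond `b = 0`, the landed bath-bond reduction
  `V_N(0,t) ≤ 4γT²∫₀ᵗ(1−θ_N) + 8E_{μ_T}[e₀²]` (`stub_bathBondReduction_of_kernelFacts` + kernel detailed balance + Dynkin +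
  static covariance, all landed) and the landed `N`-uniform statics `E_{μ_T}[e₀²] ≤ σ²` (`localEnergyMoment`); the
  reduction is pointwise in `t`, so the window plays no role in it.
* `lightConeBondHeat_of_lightConeDeficitUpperTail` — (S_lc) from the POINTWISE tail `1 − θ_N(s) ≤ C/√s` on `[1, a·N]`
  (bridge `pinnedChain_deficitIntegral_le_of_upperTail`, instantiated with `c := a/N`).
* `lightConeDeficitCesaro_of_deficitCesaroEW`, `lightConeBondHeat_of_deficitCesaroEW` — the Thouless-window Cesàro bound (the registered open stub
  `stub_deficitCesaroEW` of crux 9120) implies the light-cone one (`a := c`, `N ≥ 1`): containment of the inputs,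
  matching `lightConeBondHeat_of_subdiffusiveBondHeat` for the outputs.

Nothing here closes the item: each hypothesis is an `N`-uniform dynamical statement of open-problem calibre
(BLR2000 §6.3); the file is the glue `light-cone child → (S_lc)`.
-/

noncomputable section

open MeasureTheory Set Filter Topology

namespace Summit.AtomisticToContinuum.FouriersLaw.Theorems.LightConeBondHeat

open Literature.MathematicalPhysics.KineticTheory.HeatConduction
open Summit.AtomisticToContinuum.FouriersLaw.Theorems.SubdiffusiveBondHeat
open Summit.AtomisticToContinuum.FouriersLaw.Theses.BondHeatUncertainty (LightConeBondHeat)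

/-- **(S_lc) from the light-cone Cesàro Edwards–Wilkinson bound of the boundary deficit curve**: if for all parameters
`∃ C, a > 0, N₀` with `∫₀ᵗ (1 − θ_N(s)) ds ≤ C√t` for `N ≥ N₀`, `1 ≤ t ≤ a·N` (`θ_N`, `K_N` VERBATIM the `let θ`, `let K`
of route `BoundaryEscapeDeficit`), then `LightConeBondHeat`.  Witness bond `b = 0`; constants
`A = 4γT² max(C,0) + 8 max(σ²,0)`, same `a`, `N₀ ↦ max(N₀, 2)`. [folklore] -/
theorem lightConeBondHeat_of_lightConeDeficitCesaro :
    (∀ ω₂ lam β γ : ℝ, 0 < ω₂ → 0 < lam → 0 < β → 0 < γ → ∀ T : ℝ, 0 < T → ∃ C a : ℝ, 0 < a ∧ ∃ N₀ : ℕ,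
      ∀ N : ℕ, N₀ ≤ N → ∀ t : ℝ, 1 ≤ t → t ≤ a * (N : ℝ) →
        (∫ s in (0 : ℝ)..t, (1 - γ / T ^ 2 * (∫ u in (0 : ℝ)..s,
          if h : 0 < N then
            ∫ z, ((z.2 ⟨0, h⟩) ^ 2 - T) *
                (∫ y, ((y.2 ⟨0, h⟩) ^ 2 - T) ∂((pinnedChain ω₂ lam β γ).transitionKernel N T T u.toNNReal z))
              ∂((pinnedChain ω₂ lam β γ).gibbsMeasure N T)
          else 0))) ≤ C * Real.sqrt t) →
    LightConeBondHeat := by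
  intro h ω₂ lam β γ hω hl hβ hγ T hT
  obtain ⟨σ2, hσ⟩ := localEnergyMoment ω₂ lam β γ hω hl hβ hγ T hT
  obtain ⟨C, a, ha, N₀, hC⟩ := h ω₂ lam β γ hω hl hβ hγ T hT
  refine ⟨4 * γ * T ^ 2 * max C 0 + 8 * max σ2 0, a, ha, max N₀ 2, fun N hN => ⟨0, ?_, fun t ht hta => ?_⟩⟩
  · have h2 : 2 ≤ N := le_trans (le_max_right _ _) hN
    omega
  · have h2 : 1 < N := lt_of_lt_of_le (by norm_num) (le_trans (le_max_right _ _) hN)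
    have hN0 : 0 < N := Nat.zero_lt_of_lt h2
    have hN₀ : N₀ ≤ N := le_trans (le_max_left _ _) hN
    have ht0 : 0 ≤ t := le_trans zero_le_one ht
    have hsqrt0 : 0 ≤ Real.sqrt t := Real.sqrt_nonneg t
    have hsqrt1 : 1 ≤ Real.sqrt t := by rw [← Real.sqrt_one]; exact Real.sqrt_le_sqrt ht
    -- the light-cone Cesàro hypothesis at this `N`, `t`
    have hces := hC N hN₀ t ht hta
    simp only [dif_pos hN0] at hces
    -- the landed bath-bond reduction (pointwise in `t`) and the landed `N`-uniform statics
    have hred := stub_bathBondReduction_of_kernelFacts ω₂ lam β γ hω hl hβ hγ T hT N h2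
      (stub_kernelDetailedBalance ω₂ lam β γ hω hl hβ hγ T hT N h2)
      (stub_siteEnergyDynkin ω₂ lam β γ hω hl hβ hγ T hT N h2)
      (stub_siteEnergyCurrentCovariance ω₂ lam β γ hω hl hβ hγ T hT N h2) t ht0
    have hmom := hσ N h2
    simp only [dif_pos hN0]
    have hγT : 0 ≤ 4 * γ * T ^ 2 := by positivity
    have hces' := hces.trans (mul_le_mul_of_nonneg_right (le_max_left C 0) hsqrt0)
    have hmom' : ∫ z, ((z.2 ⟨0, Nat.zero_lt_of_lt h2⟩) ^ 2 / 2 +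
        (pinnedChain ω₂ lam β γ).U (z.1 ⟨0, Nat.zero_lt_of_lt h2⟩) +
        (pinnedChain ω₂ lam β γ).V (z.1 ⟨1, h2⟩ - z.1 ⟨0, Nat.zero_lt_of_lt h2⟩) / 2) ^ 2
          ∂((pinnedChain ω₂ lam β γ).gibbsMeasure N T) ≤ max σ2 0 * Real.sqrt t :=
      calc _ ≤ max σ2 0 := hmom.trans (le_max_left _ _)
        _ = max σ2 0 * 1 := (mul_one _).symm
        _ ≤ max σ2 0 * Real.sqrt t := mul_le_mul_of_nonneg_left hsqrt1 (le_max_right _ _)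
    have h1 := mul_le_mul_of_nonneg_left hces' hγT
    calc _ ≤ _ := hred
      _ ≤ 4 * γ * T ^ 2 * (max C 0 * Real.sqrt t) + 8 * (max σ2 0 * Real.sqrt t) := by linarith
      _ = (4 * γ * T ^ 2 * max C 0 + 8 * max σ2 0) * Real.sqrt t := by ring

/-- **(S_lc) from the light-cone pointwise upper tail of the boundary deficit curve** `1 − θ_N(s) ≤ C/√s` on
`[1, a·N]`, `N ≥ N₀` (the light-cone shadow of card A's `C⁺` / the triad's `DeficitUpperTail`), via the landed bridge
`pinnedChain_deficitIntegral_le_of_upperTail` (pointwise ⇒ Cesàro with `C ↦ 1 + 2γ + 2 max(C,0)`, window written as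
`(a/N)·N² = a·N`) and `lightConeBondHeat_of_lightConeDeficitCesaro`. [folklore] -/
theorem lightConeBondHeat_of_lightConeDeficitUpperTail :
    (∀ ω₂ lam β γ : ℝ, 0 < ω₂ → 0 < lam → 0 < β → 0 < γ → ∀ T : ℝ, 0 < T → ∃ C a : ℝ, 0 < a ∧ ∃ N₀ : ℕ,
      ∀ N : ℕ, N₀ ≤ N → ∀ s : ℝ, 1 ≤ s → s ≤ a * (N : ℝ) →
        1 - γ / T ^ 2 * (∫ u in (0 : ℝ)..s,
          if h : 0 < N then
            ∫ z, ((z.2 ⟨0, h⟩) ^ 2 - T) *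
                (∫ y, ((y.2 ⟨0, h⟩) ^ 2 - T) ∂((pinnedChain ω₂ lam β γ).transitionKernel N T T u.toNNReal z))
              ∂((pinnedChain ω₂ lam β γ).gibbsMeasure N T)
          else 0) ≤ C / Real.sqrt s) →
    LightConeBondHeat := by
  intro h
  refine lightConeBondHeat_of_lightConeDeficitCesaro fun ω₂ lam β γ hω hl hβ hγ T hT => ?_
  obtain ⟨C, a, ha, N₀, hC⟩ := h ω₂ lam β γ hω hl hβ hγ T hT
  refine ⟨1 + 2 * γ + 2 * max C 0, a, ha, max N₀ 1, fun N hN t ht hta => ?_⟩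
  have hN₀ : N₀ ≤ N := le_trans (le_max_left _ _) hN
  have hN1 : 0 < N := lt_of_lt_of_le Nat.one_pos (le_trans (le_max_right _ _) hN)
  -- write the light-cone window as `(a/N)·N²`
  have hNR : (0 : ℝ) < (N : ℝ) := by exact_mod_cast hN1
  have hwin : a / (N : ℝ) * (N : ℝ) ^ 2 = a * (N : ℝ) := by
    field_simp
  have htail : ∀ s : ℝ, 1 ≤ s → s ≤ a / (N : ℝ) * (N : ℝ) ^ 2 →
      1 - γ / T ^ 2 * (∫ u in (0 : ℝ)..s,
        ∫ z, ((z.2 ⟨0, hN1⟩) ^ 2 - T) *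
            (∫ y, ((y.2 ⟨0, hN1⟩) ^ 2 - T) ∂((pinnedChain ω₂ lam β γ).transitionKernel N T T u.toNNReal z))
          ∂((pinnedChain ω₂ lam β γ).gibbsMeasure N T)) ≤ C / Real.sqrt s := fun s hs hsa => by
    rw [hwin] at hsa
    have h' := hC N hN₀ s hs hsa
    simp only [dif_pos hN1] at h'
    exact h'
  have hta' : t ≤ a / (N : ℝ) * (N : ℝ) ^ 2 := by rw [hwin]; exact hta
  simp only [dif_pos hN1]
  exact pinnedChain_deficitIntegral_le_of_upperTail hω hl hβ hγ hT hN1 ht hta' htail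

/-- **Containment of the inputs**: the Thouless-window Cesàro bound (the registered open stub `stub_deficitCesaroEW` of crux
stmt-9120, window `1 ≤ t ≤ cN²`) implies the light-cone one (window `1 ≤ t ≤ c·N`), with `a := c` and `N₀ ↦ max(N₀,1)`,
since `c·N ≤ c·N²` for `N ≥ 1` — the input-side twin of `lightConeBondHeat_of_subdiffusiveBondHeat`. [folklore] -/
theorem lightConeDeficitCesaro_of_deficitCesaroEW
    (h : ∀ ω₂ lam β γ : ℝ, 0 < ω₂ → 0 < lam → 0 < β → 0 < γ → ∀ T : ℝ, 0 < T → ∃ C c : ℝ, 0 < c ∧ ∃ N₀ : ℕ,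
      ∀ N : ℕ, N₀ ≤ N → ∀ t : ℝ, 1 ≤ t → t ≤ c * (N : ℝ) ^ 2 →
        (∫ s in (0 : ℝ)..t, (1 - γ / T ^ 2 * (∫ u in (0 : ℝ)..s,
          if h : 0 < N then
            ∫ z, ((z.2 ⟨0, h⟩) ^ 2 - T) *
                (∫ y, ((y.2 ⟨0, h⟩) ^ 2 - T) ∂((pinnedChain ω₂ lam β γ).transitionKernel N T T u.toNNReal z))
              ∂((pinnedChain ω₂ lam β γ).gibbsMeasure N T)
          else 0))) ≤ C * Real.sqrt t) :
    ∀ ω₂ lam β γ : ℝ, 0 < ω₂ → 0 < lam → 0 < β → 0 < γ → ∀ T : ℝ, 0 < T → ∃ C a : ℝ, 0 < a ∧ ∃ N₀ : ℕ,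
      ∀ N : ℕ, N₀ ≤ N → ∀ t : ℝ, 1 ≤ t → t ≤ a * (N : ℝ) →
        (∫ s in (0 : ℝ)..t, (1 - γ / T ^ 2 * (∫ u in (0 : ℝ)..s,
          if h : 0 < N then
            ∫ z, ((z.2 ⟨0, h⟩) ^ 2 - T) *
                (∫ y, ((y.2 ⟨0, h⟩) ^ 2 - T) ∂((pinnedChain ω₂ lam β γ).transitionKernel N T T u.toNNReal z))
              ∂((pinnedChain ω₂ lam β γ).gibbsMeasure N T)
          else 0))) ≤ C * Real.sqrt t := by
  intro ω₂ lam β γ hω hl hβ hγ T hT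
  obtain ⟨C, c, hc, N₀, hC⟩ := h ω₂ lam β γ hω hl hβ hγ T hT
  refine ⟨C, c, hc, max N₀ 1, fun N hN t ht htc => hC N (le_trans (le_max_left _ _) hN) t ht ?_⟩
  have hN1 : (1 : ℝ) ≤ (N : ℝ) := by exact_mod_cast le_trans (le_max_right _ _) hN
  have hcN : c * (N : ℝ) ≤ c * (N : ℝ) ^ 2 := by
    have : (N : ℝ) ≤ (N : ℝ) ^ 2 := by nlinarith
    exact mul_le_mul_of_nonneg_left this hc.le
  exact htc.trans hcN

/-- **Corollary** (ties the two transfers together): the registered open stub `stub_deficitCesaroEW` of crux stmt-9120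
(Thouless window) already gives (S_lc) through the LIGHT-CONE transfer — containment of the inputs followed by
`lightConeBondHeat_of_lightConeDeficitCesaro`; the same conclusion as `(S) ⇒ (S_lc)` composed with
`subdiffusiveBondHeat_of_deficitCesaroEW`, reached without passing through (S). [folklore] -/
theorem lightConeBondHeat_of_deficitCesaroEW
    (h : ∀ ω₂ lam β γ : ℝ, 0 < ω₂ → 0 < lam → 0 < β → 0 < γ → ∀ T : ℝ, 0 < T → ∃ C c : ℝ, 0 < c ∧ ∃ N₀ : ℕ,
      ∀ N : ℕ, N₀ ≤ N → ∀ t : ℝ, 1 ≤ t → t ≤ c * (N : ℝ) ^ 2 →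
        (∫ s in (0 : ℝ)..t, (1 - γ / T ^ 2 * (∫ u in (0 : ℝ)..s,
          if h : 0 < N then
            ∫ z, ((z.2 ⟨0, h⟩) ^ 2 - T) *
                (∫ y, ((y.2 ⟨0, h⟩) ^ 2 - T) ∂((pinnedChain ω₂ lam β γ).transitionKernel N T T u.toNNReal z))
              ∂((pinnedChain ω₂ lam β γ).gibbsMeasure N T)
          else 0))) ≤ C * Real.sqrt t) :
    LightConeBondHeat :=
  lightConeBondHeat_of_lightConeDeficitCesaro (lightConeDeficitCesaro_of_deficitCesaroEW h)

end Summit.AtomisticToContinuum.FouriersLaw.Theorems.LightConeBondHeat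

end
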